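import Summits.QuantumFields.YangMills.Theorems.FluctuationComparisonRegPrIntLS2BetaQuaternionReadDictionary
import Summits.QuantumFields.YangMills.Theorems.FluctuationComparisonRegPrIntLS2BetaQuaternionReadFibreIdentity
import Summits.QuantumFields.YangMills.Theorems.FluctuationComparisonRegPrIntLS2BetaChartReadDescentDerivKStepSupT3
import HarnessLib

/-!
# S2β · Q8 — THE VALUE DICTIONARY `Mq ↔ Ψ_{K−J}` AND THE SECOND-ORDER REMAINDER OF THE QUATERNION READ IN (β)'s CURRENCY

Cell `ym3-torus` (rung R3 = continuum `SU(2)` YM₃ on T³ at fixed lattice data — NOT d = 4, NOT infinite volume, NOT a mass gap, NOT Clay).  Width seat `ym3-torus-px5` (gen 23);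
crux `stmt-QuantumFields-20520`, LINE g18-1 S2β: «CRIT-ax» ⟸ «MULT♭-ax» ⟸ ✓p825995 `multAx_of_letters` ⟸ {Thm-1 pair, (RINV-curl)_q ✓p827199, AVG₂♭-ax_q}; AVG₂♭-ax_q ⟸ TAYLOR♭_q
(px17 g22 ✓`…QuaternionReadFibreIdentity.avg2_of_taylor`), whose vector is the telescope of ONE-STEP brackets (Q7 ✓`…QuaternionReadTowerTelescope.chord_sub_fderiv_qRead_chord_eq_sum`);
`--kind proof --supports stmt-QuantumFields-20520 --as helper`, count-neutral, DEFINITION-FREE (0 `def`, 0 `instance`, 0 `notation`, 0 `sorry`, default heartbeats).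

WHY.  TAYLOR♭_q's summand and every Q7 bracket have the shape `Mq_{J←K}(U₀) ζ̃ B − DMq_{J←K}(U₀) (sinc∘ζ̃ • ζ̃) B` (`ζ̃` = exact chart coordinates, `sinc‖ζ̃ ℓ‖ • ζ̃ ℓ` = the imVec chord,
px17 ✓`chordField_eq_sinc_smul_logChord`, Q7 ✓`qRead_apply_logVec_chord`).  The (β) brick (px13 g26, (β-1) ✓`…ChartReadCplxExtension` → (β-3)) bounds the second-order remainder
`Ψ(X) − DΨ(0)X` of the LOG-CHART iterate `Ψ_{K−J}` of ✓p823800 (px13∕px16's currency).  Q3 ✓p825936 `coord_qfderiv_apply` is the dictionary for the DERIVATIVE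
(`coord ((DMq η) B) = DΨ(0)(coord∘η)(σ B)`, `coord x := ⟨su2Coord (rev x), _⟩`, `σ := bondShift`).  THIS FILE is the dictionary for the VALUE `Mq ζ̃ B` and the resulting EXACT split
of the remainder into (β)'s object plus two explicit THIRD-order chart terms.

WHAT IS PROVED (sorry-free; `Ψ A c := Λ(Ū^{K−J}(Θ^B(A)·U₀)(c)·Ū^{K−J}(U₀)(c)⁻¹)` written out; `y := Ψ(coord∘ζ̃)(σB)`).
* §1 `coord_smul`, `coord_sub` (the Pauli coordinate is ℝ-linear, via ✓`exists_coordEquiv`), `chartRead_iter_coord_apply_eq_logChart` (`y = Λ(D_{J,K}(expPoint ζ̃•U₀) B·D_{J,K}U₀ B⁻¹)` —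
  `descendTo = fieldShift ∘ Ū^{K−J}` is `rfl`, FILE B ✓`chartRead_descendTo_eq_comp`, and `Θ ∘ coord = expPoint` ✓`expPoint_eq_expChart`).
* §2 ★★`coord_qRead_apply` — on the log-chart window at `B` (`‖↑(D_{J,K}(expPoint ζ̃•U₀) B·D_{J,K}U₀ B⁻¹) − 1‖ < innerRadius`): **`coord (Mq_{J←K}(U₀) ζ̃ B) = sinc‖y‖ • y`**
  (`Θ(Λ g) = g` ✓`expChart_logChart`, px17 ✓`imVec_su2Quat_expPoint`, isometry ✓`norm_coord_eq`); `norm_qRead_apply_eq` — `‖Mq ζ̃ B‖ = |sinc‖y‖|·‖y‖ ≤ ‖y‖`.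
* §3 ★★★`coord_qRead_sub_qfderiv_sinc_eq` — under Q1's guard at `(J,K)` and the window at `B`, with `X := coord∘ζ̃`:
  **`coord (Mq ζ̃ B − DMq (sinc∘ζ̃•ζ̃) B) = (y − DΨ(0) X (σB)) + ((sinc‖y‖ − 1)•y − DΨ(0) ((sinc∘ζ̃ − 1)•X) (σB))`**;
  ★★★`norm_qRead_sub_qfderiv_sinc_le` — **`‖Mq ζ̃ B − DMq (sinc∘ζ̃•ζ̃) B‖ ≤ ‖y − DΨ(0)X(σB)‖ + ‖y‖³∕6 + ‖DΨ(0)((sinc∘ζ̃ − 1)•X)(σB)‖`** (px17 ✓`norm_sinc_smul_sub_self_le`),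
  `norm_sinc_sub_one_smul_coord_le` (the third-order input field: `‖((sinc‖ζ̃ b‖ − 1)•X b)‖ ≤ ‖ζ̃ b‖³∕6` bondwise).
* §4 ★★`norm_qRead_sub_qfderiv_sinc_le_priced` — the same with the last term priced by (D2) ✓`…DerivKStepSupT3.norm_fderiv_chartRead_descendTo_expPoint_apply_le` through (E):
  `… ≤ ‖y − DΨ(0)X(σB)‖ + ‖y‖³∕6 + (1 + 4(d+2))·exp(c₃·Σ_{i<K−J}(5L)²∕4·θ(K−i))·L^{K−J}·‖ζ̃‖_∞³∕6` — so TAYLOR♭_q ∕ each Q7 bracket IS (β)'s `‖Ψ(X) − DΨ(0)X‖` at `σB` up to two explicit cubes.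

HONEST SCOPE.  Dictionary bookkeeping over ✓p825180∕✓p825936∕px13 (E)(D2)∕px17 Q6; nothing of Bałaban's analysis is asserted or proved ([Balaban1985Averaging] Prop. 3 (123) — the bound on
`Ψ(X) − DΨ(0)X` — is (β-3), NOT here); AVG₂♭-ax_q, TAYLOR♭_q, «MULT♭-ax», «CRIT-ax», (D-ax)∕(F-ax), GAP♯∘ (`stub_uniformFibreGapOrbit`, registry 3732b7df UNTOUCHED), S2β, the five
registered stubs, 20520, 19936, 19200, `YM3TorusSU2` NOT proved; no summit statement is proved by a helper; rung R3 — NOT d = 4, NOT infinite volume, NOT a mass gap, NOT Clay.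

References: T. Bałaban, CMP **98** (1985) 17–51 [Balaban1985Averaging] (Prop. 3 (121)–(124) p.36, (127)–(128) p.37, (148)–(149) p.40); CMP **109** (1987) 249–301 [Balaban1987RG1]
((0.4), (0.11) p.253); CMP **102** (1985) 255–275 [Balaban1985UV3] ((7) p.257, p.260: the chart `A ↦ exp iA`).
-/

set_option autoImplicit false

noncomputable section

open scoped Matrix.Norms.L2Operator Topology RealInnerProductSpace Quaternion
open Filter Set Function
open Literature.MathematicalPhysics.QuantumLattice (su2Quat fundamentalRep fundamentalRep_apply)
open Literature.MathematicalPhysics.QuantumFieldTheory.Balaban1983to89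
open Literature.MathematicalPhysics.QuantumFieldTheory.Balaban1983to89.HaarExponentialChart
open Literature.MathematicalPhysics.QuantumFieldTheory.Balaban1983to89.HaarExponentialChart.IsChartRep
open Literature.MathematicalPhysics.QuantumFieldTheory.Balaban1983to89.BlockAveraging (blockAvg)
open Literature.MathematicalPhysics.QuantumFieldTheory.Balaban1983to89.ExpMeanLog (expMeanLogSU deltaSU deltaSU_pos)
open Literature.MathematicalPhysics.QuantumFieldTheory.Balaban1983to89.Node00
open Literature.MathematicalPhysics.QuantumFieldTheory.Balaban1983to89.T3ContinuumYM3Torus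
open Literature.MathematicalPhysics.QuantumFieldTheory.Balaban1983to89.T3UnitLawDensityEML (ℰp)
open Literature.MathematicalPhysics.QuantumFieldTheory.Balaban1983to89.T3UnitScaleTilt
open Literature.MathematicalPhysics.QuantumFieldTheory.Balaban1983to89.T3TiltDescent
open Literature.MathematicalPhysics.QuantumFieldTheory.Balaban1983to89.T3LevelShift (fieldShift bondShift)
open Literature.MathematicalPhysics.QuantumFieldTheory.Balaban1983to89.T4HaarSU2ExpChart (expPoint expPoint_zero imQuat su2Quat_expPoint)
open Literature.MathematicalPhysics.QuantumFieldTheory.Balaban1983to89.T4ExpWindowSmallField (imVec logVec)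
open Literature.MathematicalPhysics.QuantumFieldTheory.Balaban1983to89.B10Eq18SigmaSU2 (su2Coord)
open Literature.MathematicalPhysics.QuantumFieldTheory.Balaban1983to89.B13HaarSigmaJacobian (su2Coordₗ su2Coordₗ_apply_coe)
open Literature.MathematicalPhysics.QuantumFieldTheory.Balaban1983to89.B10Eq18SigmaSU2Haar (rev)
open Literature.MathematicalPhysics.QuantumFieldTheory.Balaban1983to89.T4Continuum
open Summit.QuantumFields.YangMills.Theorems.FluctuationComparisonRegPrIntLS2BetaChartReadDescentOntoExpPoint
  (su2Coord_rev_mem_lie expPoint_eq_expChart piExpPoint_translate_eq exists_coordEquiv)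
open Summit.QuantumFields.YangMills.Theorems.FluctuationComparisonRegPrIntLS2BetaChartReadDescentDerivKStepSupT3 (norm_coord_eq norm_coordField_eq
  norm_fderiv_chartRead_descendTo_expPoint_apply_le)
open Summit.QuantumFields.YangMills.Theorems.FluctuationComparisonRegPrIntLS2BetaChartReadDescentDerivFactorisation (fderiv_chartRead_descendTo_expPoint_apply)
open Summit.QuantumFields.YangMills.Theorems.FluctuationComparisonRegPrIntLS2BetaQuaternionReadDictionary (coord_qfderiv_apply)
open Summit.QuantumFields.YangMills.Theorems.FluctuationComparisonRegPrIntLS2BetaQuaternionReadFibreIdentity (imVec_su2Quat_expPoint norm_sinc_smul_sub_self_le)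

namespace Summit.QuantumFields.YangMills.Theorems.FluctuationComparisonRegPrIntLS2BetaQuaternionReadRemainderDictionary

variable {F : T3Family}

/-! ## §1 The Pauli coordinate is linear; the chart-read iterate at the coordinates of `ζ̃` is the log chart of the relative coarse field -/

section Coord

/-- `coord (c • x) = c • coord x` (`rev` is a linear isometry, `su2Coord` is the linear `su2Coordₗ`). [cite: Balaban1985UV3, p. 260 (bookkeeping)] -/
theorem coord_smul (c : ℝ) (x : EuclideanSpace ℝ (Fin 3)) :
    (⟨su2Coord (rev (c • x)), su2Coord_rev_mem_lie (c • x)⟩ : (specialUnitaryLogChart (Fin 2)).lie) =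
      c • (⟨su2Coord (rev x), su2Coord_rev_mem_lie x⟩ : (specialUnitaryLogChart (Fin 2)).lie) := by
  apply Subtype.ext
  have h1 : su2Coord (WithLp.ofLp (rev (c • x))) = c • su2Coord (WithLp.ofLp (rev x)) := by
    rw [map_smul, WithLp.ofLp_smul, ← su2Coordₗ_apply_coe, ← su2Coordₗ_apply_coe, map_smul]; rfl
  exact h1

/-- `coord (x − x′) = coord x − coord x′`. [cite: Balaban1985UV3, p. 260 (bookkeeping)] -/
theorem coord_sub (x x' : EuclideanSpace ℝ (Fin 3)) :
    (⟨su2Coord (rev (x - x')), su2Coord_rev_mem_lie (x - x')⟩ : (specialUnitaryLogChart (Fin 2)).lie) =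
      (⟨su2Coord (rev x), su2Coord_rev_mem_lie x⟩ : (specialUnitaryLogChart (Fin 2)).lie) -
        (⟨su2Coord (rev x'), su2Coord_rev_mem_lie x'⟩ : (specialUnitaryLogChart (Fin 2)).lie) := by
  apply Subtype.ext
  have h1 : su2Coord (WithLp.ofLp (rev (x - x'))) = su2Coord (WithLp.ofLp (rev x)) - su2Coord (WithLp.ofLp (rev x')) := by
    rw [map_sub, WithLp.ofLp_sub, ← su2Coordₗ_apply_coe, ← su2Coordₗ_apply_coe, ← su2Coordₗ_apply_coe, map_sub]; rfl
  exact h1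

/-- **THE CHART-READ ITERATE AT THE COORDINATES OF `ζ̃` IS THE LOG CHART OF THE RELATIVE COARSE FIELD**: `Ψ_{K−J}(coord∘ζ̃)(σ B) = Λ(D_{J,K}(expPoint ζ̃•U₀) B·D_{J,K}U₀ B⁻¹)`
(`descendTo = fieldShift ∘ Ū^{K−J}` is `rfl`; `Θ ∘ coord = expPoint`). [cite: Balaban1987RG1, (0.11) p.253; Balaban1985UV3, p. 260 (bookkeeping)] -/
theorem chartRead_iter_coord_apply_eq_logChart {J K : ℕ} (hJK : J ≤ K) (U₀ : GaugeField (F.P K) 0 (SU 2))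
    (ζ : PBond (F.P K) 0 → EuclideanSpace ℝ (Fin 3)) (B : PBond (F.P J) 0) :
    (fun (A : PBond (F.P K) 0 → (specialUnitaryLogChart (Fin 2)).lie) (c : PBond (F.P K) (K - J)) =>
        (isChartRep_specialUnitaryGroup (n := Fin 2)).logChart
          (Averaging.iter (fun i => blockAvg (P := F.P K) (j := i) (expMeanLogSU (n := Fin 2))) (K - J)
              (fun b => (isChartRep_specialUnitaryGroup (n := Fin 2)).expChart (A b) * U₀ b) c *
            (Averaging.iter (fun i => blockAvg (P := F.P K) (j := i) (expMeanLogSU (n := Fin 2))) (K - J) U₀ c)⁻¹))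
        (fun b => (⟨su2Coord (rev (ζ b)), su2Coord_rev_mem_lie (ζ b)⟩ : (specialUnitaryLogChart (Fin 2)).lie))
        (bondShift (F.sitesPerDir_eq (m := F.m) (K := J) (j := 0) (m' := F.m) (K' := K) (j' := K - J) (by omega)) B) =
      (isChartRep_specialUnitaryGroup (n := Fin 2)).logChart
        (descendTo F ℰp J K hJK (fun ℓ => expPoint (ζ ℓ) * U₀ ℓ) B * (descendTo F ℰp J K hJK U₀ B)⁻¹) := by
  have hfield : (fun b => (isChartRep_specialUnitaryGroup (n := Fin 2)).expChart
      ((⟨su2Coord (rev (ζ b)), su2Coord_rev_mem_lie (ζ b)⟩ : (specialUnitaryLogChart (Fin 2)).lie)) * U₀ b : GaugeField (F.P K) 0 (SU 2)) =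
      fun ℓ => expPoint (ζ ℓ) * U₀ ℓ := (piExpPoint_translate_eq U₀ ζ).symm
  simp only [hfield]
  rfl

end Coord

/-! ## §2 The value dictionary: `coord (Mq ζ̃ B) = sinc‖y‖ • y` on the window -/

section Value

/-- ★★ **THE VALUE DICTIONARY**: on the log-chart window at `B`, the Pauli coordinates of the quaternion read `Mq_{J←K}(U₀) ζ̃ B` are `sinc‖y‖ • y` with `y := Ψ_{K−J}(coord∘ζ̃)(σ B)` the
LOG-CHART read (`g = Θ(Λ g) = expPoint (coord⁻¹ (Λ g))`, `imVec (su2Quat (expPoint v)) = sinc‖v‖ • v`, `‖coord v‖ = ‖v‖`). [cite: Balaban1985UV3, p. 260; Balaban1987RG1, (0.4), (0.11) p.253 (bookkeeping)] -/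
theorem coord_qRead_apply {J K : ℕ} (hJK : J ≤ K) (U₀ : GaugeField (F.P K) 0 (SU 2)) (ζ : PBond (F.P K) 0 → EuclideanSpace ℝ (Fin 3)) (B : PBond (F.P J) 0)
    (hwin : ‖((descendTo F ℰp J K hJK (fun ℓ => expPoint (ζ ℓ) * U₀ ℓ) B * (descendTo F ℰp J K hJK U₀ B)⁻¹ : SU 2) : Matrix (Fin 2) (Fin 2) ℂ) - 1‖ <
      innerRadius (specialUnitaryLogChart (Fin 2))) :
    (⟨su2Coord (rev (imVec (su2Quat (descendTo F ℰp J K hJK (fun ℓ => expPoint (ζ ℓ) * U₀ ℓ) B * (descendTo F ℰp J K hJK U₀ B)⁻¹)))),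
        su2Coord_rev_mem_lie _⟩ : (specialUnitaryLogChart (Fin 2)).lie) =
      Real.sinc ‖(isChartRep_specialUnitaryGroup (n := Fin 2)).logChart
          (descendTo F ℰp J K hJK (fun ℓ => expPoint (ζ ℓ) * U₀ ℓ) B * (descendTo F ℰp J K hJK U₀ B)⁻¹)‖ •
        (isChartRep_specialUnitaryGroup (n := Fin 2)).logChart
          (descendTo F ℰp J K hJK (fun ℓ => expPoint (ζ ℓ) * U₀ ℓ) B * (descendTo F ℰp J K hJK U₀ B)⁻¹) := by
  set g : SU 2 := descendTo F ℰp J K hJK (fun ℓ => expPoint (ζ ℓ) * U₀ ℓ) B * (descendTo F ℰp J K hJK U₀ B)⁻¹ with hg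
  obtain ⟨E, hE⟩ := exists_coordEquiv (F.P J) 0
  -- a vector whose Pauli coordinates are `Λ g`
  set v : EuclideanSpace ℝ (Fin 3) := E.symm (fun _ : PBond (F.P J) 0 => (isChartRep_specialUnitaryGroup (n := Fin 2)).logChart g) B with hv
  have hcv : (⟨su2Coord (rev v), su2Coord_rev_mem_lie v⟩ : (specialUnitaryLogChart (Fin 2)).lie) = (isChartRep_specialUnitaryGroup (n := Fin 2)).logChart g := by
    rw [hv, ← hE (E.symm fun _ => (isChartRep_specialUnitaryGroup (n := Fin 2)).logChart g) B, E.apply_symm_apply]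
  have hρ : ‖fundamentalRep (Fin 2) g - 1‖ < innerRadius (specialUnitaryLogChart (Fin 2)) := by
    rw [fundamentalRep_apply]; exact hwin
  have hgv : g = expPoint v := by
    rw [expPoint_eq_expChart, hcv, (isChartRep_specialUnitaryGroup (n := Fin 2)).expChart_logChart hρ]
  have hnorm : ‖v‖ = ‖(isChartRep_specialUnitaryGroup (n := Fin 2)).logChart g‖ := by rw [← hcv, norm_coord_eq]
  have himv : imVec (su2Quat g) = Real.sinc ‖v‖ • v := by rw [hgv, imVec_su2Quat_expPoint]
  rw [himv, coord_smul, hcv, hnorm]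

/-- `‖Mq ζ̃ B‖ = |sinc‖y‖|·‖y‖` and hence `≤ ‖y‖` on the window (`|sinc| ≤ 1`). [cite: Balaban1985UV3, p. 260 (bookkeeping)] -/
theorem norm_qRead_apply_le {J K : ℕ} (hJK : J ≤ K) (U₀ : GaugeField (F.P K) 0 (SU 2)) (ζ : PBond (F.P K) 0 → EuclideanSpace ℝ (Fin 3)) (B : PBond (F.P J) 0)
    (hwin : ‖((descendTo F ℰp J K hJK (fun ℓ => expPoint (ζ ℓ) * U₀ ℓ) B * (descendTo F ℰp J K hJK U₀ B)⁻¹ : SU 2) : Matrix (Fin 2) (Fin 2) ℂ) - 1‖ <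
      innerRadius (specialUnitaryLogChart (Fin 2))) :
    ‖imVec (su2Quat (descendTo F ℰp J K hJK (fun ℓ => expPoint (ζ ℓ) * U₀ ℓ) B * (descendTo F ℰp J K hJK U₀ B)⁻¹))‖ ≤
      ‖(isChartRep_specialUnitaryGroup (n := Fin 2)).logChart
          (descendTo F ℰp J K hJK (fun ℓ => expPoint (ζ ℓ) * U₀ ℓ) B * (descendTo F ℰp J K hJK U₀ B)⁻¹)‖ := by
  rw [← norm_coord_eq, coord_qRead_apply (F := F) hJK U₀ ζ B hwin, norm_smul, Real.norm_eq_abs]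
  exact (mul_le_of_le_one_left (norm_nonneg _) (Real.abs_sinc_le_one _))

end Value

/-! ## §3 The remainder `Mq ζ̃ − DMq (sinc∘ζ̃ • ζ̃)` split into (β)'s object and two third-order chart terms -/

section Remainder

/-- ★★★ **THE EXACT SPLIT OF THE QUATERNION-READ REMAINDER IN (β)'s CURRENCY** (Q1's guard at `(J,K)`; the window at `B`): with `X := coord∘ζ̃`, `y := Ψ_{K−J}(X)(σB)`,
`coord (Mq ζ̃ B − DMq (sinc∘ζ̃•ζ̃) B) = (y − DΨ_{K−J}(0) X (σB)) + ((sinc‖y‖ − 1)•y − DΨ_{K−J}(0) ((sinc∘ζ̃ − 1)•X) (σB))` — (β)'s second-order remainder of the log-chart read plus two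
THIRD-order chart terms (Q3 ✓`coord_qfderiv_apply` for the derivative, §2 for the value). [cite: Balaban1985Averaging, Prop. 3 (121)-(123) p.36; Balaban1987RG1, (0.4), (0.11) p.253; Balaban1985UV3, p. 260] -/
theorem coord_qRead_sub_qfderiv_sinc_eq {J K : ℕ} (hJK : J ≤ K) {θ : ℕ → ℝ} (hθ0 : ∀ i, 0 ≤ θ i) {α : ℝ}
    (hθα : ∀ i, J < i → i ≤ K → (((5 * F.L : ℕ) : ℝ) ^ 2 / 4) * θ i ≤ α)
    (hα24 : α ≤ 1 / 24) (hαδ : α < deltaSU (Fin 2)) (hαL : 157 * α < ((F.L : ℝ) ^ 2)⁻¹)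
    {U₀ : GaugeField (F.P K) 0 (SU 2)} (hUg : U₀ ∈ histGood F ℰp θ K J)
    (ζ : PBond (F.P K) 0 → EuclideanSpace ℝ (Fin 3)) (B : PBond (F.P J) 0)
    (hwin : ‖((descendTo F ℰp J K hJK (fun ℓ => expPoint (ζ ℓ) * U₀ ℓ) B * (descendTo F ℰp J K hJK U₀ B)⁻¹ : SU 2) : Matrix (Fin 2) (Fin 2) ℂ) - 1‖ <
      innerRadius (specialUnitaryLogChart (Fin 2))) :
    (⟨su2Coord (rev (imVec (su2Quat (descendTo F ℰp J K hJK (fun ℓ => expPoint (ζ ℓ) * U₀ ℓ) B * (descendTo F ℰp J K hJK U₀ B)⁻¹)) -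
        fderiv ℝ (fun (ζ : PBond (F.P K) 0 → EuclideanSpace ℝ (Fin 3)) (B : PBond (F.P J) 0) =>
          imVec (su2Quat (descendTo F ℰp J K hJK (fun ℓ => expPoint (ζ ℓ) * U₀ ℓ) B * (descendTo F ℰp J K hJK U₀ B)⁻¹))) 0
          (fun ℓ => Real.sinc ‖ζ ℓ‖ • ζ ℓ) B)), su2Coord_rev_mem_lie _⟩ : (specialUnitaryLogChart (Fin 2)).lie) =
      ((isChartRep_specialUnitaryGroup (n := Fin 2)).logChart
            (descendTo F ℰp J K hJK (fun ℓ => expPoint (ζ ℓ) * U₀ ℓ) B * (descendTo F ℰp J K hJK U₀ B)⁻¹) -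
          fderiv ℝ (fun (A : PBond (F.P K) 0 → (specialUnitaryLogChart (Fin 2)).lie) (c : PBond (F.P K) (K - J)) =>
              (isChartRep_specialUnitaryGroup (n := Fin 2)).logChart
                (Averaging.iter (fun i => blockAvg (P := F.P K) (j := i) (expMeanLogSU (n := Fin 2))) (K - J)
                    (fun b => (isChartRep_specialUnitaryGroup (n := Fin 2)).expChart (A b) * U₀ b) c *
                  (Averaging.iter (fun i => blockAvg (P := F.P K) (j := i) (expMeanLogSU (n := Fin 2))) (K - J) U₀ c)⁻¹)) 0
            (fun b => (⟨su2Coord (rev (ζ b)), su2Coord_rev_mem_lie (ζ b)⟩ : (specialUnitaryLogChart (Fin 2)).lie))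
            (bondShift (F.sitesPerDir_eq (m := F.m) (K := J) (j := 0) (m' := F.m) (K' := K) (j' := K - J) (by omega)) B)) +
        ((Real.sinc ‖(isChartRep_specialUnitaryGroup (n := Fin 2)).logChart
              (descendTo F ℰp J K hJK (fun ℓ => expPoint (ζ ℓ) * U₀ ℓ) B * (descendTo F ℰp J K hJK U₀ B)⁻¹)‖ - 1) •
            (isChartRep_specialUnitaryGroup (n := Fin 2)).logChart
              (descendTo F ℰp J K hJK (fun ℓ => expPoint (ζ ℓ) * U₀ ℓ) B * (descendTo F ℰp J K hJK U₀ B)⁻¹) -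
          fderiv ℝ (fun (A : PBond (F.P K) 0 → (specialUnitaryLogChart (Fin 2)).lie) (c : PBond (F.P K) (K - J)) =>
              (isChartRep_specialUnitaryGroup (n := Fin 2)).logChart
                (Averaging.iter (fun i => blockAvg (P := F.P K) (j := i) (expMeanLogSU (n := Fin 2))) (K - J)
                    (fun b => (isChartRep_specialUnitaryGroup (n := Fin 2)).expChart (A b) * U₀ b) c *
                  (Averaging.iter (fun i => blockAvg (P := F.P K) (j := i) (expMeanLogSU (n := Fin 2))) (K - J) U₀ c)⁻¹)) 0
            (fun b => (Real.sinc ‖ζ b‖ - 1) • (⟨su2Coord (rev (ζ b)), su2Coord_rev_mem_lie (ζ b)⟩ : (specialUnitaryLogChart (Fin 2)).lie))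
            (bondShift (F.sitesPerDir_eq (m := F.m) (K := J) (j := 0) (m' := F.m) (K' := K) (j' := K - J) (by omega)) B)) := by
  -- abbreviations
  set Λg := (isChartRep_specialUnitaryGroup (n := Fin 2)).logChart
      (descendTo F ℰp J K hJK (fun ℓ => expPoint (ζ ℓ) * U₀ ℓ) B * (descendTo F ℰp J K hJK U₀ B)⁻¹) with hΛg
  set DΨ := fderiv ℝ (fun (A : PBond (F.P K) 0 → (specialUnitaryLogChart (Fin 2)).lie) (c : PBond (F.P K) (K - J)) =>
      (isChartRep_specialUnitaryGroup (n := Fin 2)).logChart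
        (Averaging.iter (fun i => blockAvg (P := F.P K) (j := i) (expMeanLogSU (n := Fin 2))) (K - J)
            (fun b => (isChartRep_specialUnitaryGroup (n := Fin 2)).expChart (A b) * U₀ b) c *
          (Averaging.iter (fun i => blockAvg (P := F.P K) (j := i) (expMeanLogSU (n := Fin 2))) (K - J) U₀ c)⁻¹)) 0 with hDΨ
  set X := fun b : PBond (F.P K) 0 => (⟨su2Coord (rev (ζ b)), su2Coord_rev_mem_lie (ζ b)⟩ : (specialUnitaryLogChart (Fin 2)).lie) with hX
  set σB := bondShift (F.sitesPerDir_eq (m := F.m) (K := J) (j := 0) (m' := F.m) (K' := K) (j' := K - J) (by omega)) B with hσB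
  -- the derivative half (Q3) on the sinc-fed field, split by linearity
  have hD := coord_qfderiv_apply (F := F) hJK hθ0 hθα hα24 hαδ hαL hUg (fun ℓ => Real.sinc ‖ζ ℓ‖ • ζ ℓ) B
  have hcoordη : (fun b : PBond (F.P K) 0 => (⟨su2Coord (rev ((fun ℓ => Real.sinc ‖ζ ℓ‖ • ζ ℓ) b)), su2Coord_rev_mem_lie _⟩ :
      (specialUnitaryLogChart (Fin 2)).lie)) = X + fun b => (Real.sinc ‖ζ b‖ - 1) • X b := by
    funext b
    simp only [hX, Pi.add_apply]
    rw [coord_smul, sub_smul, one_smul, add_sub_cancel]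
  rw [hcoordη, map_add, Pi.add_apply] at hD
  -- the value half (§2)
  have hV := coord_qRead_apply (F := F) hJK U₀ ζ B hwin
  rw [coord_sub, hV, hD]
  simp only [sub_smul, one_smul]
  abel

/-- The third-order INPUT field is small: `‖(sinc‖ζ̃ b‖ − 1) • coord (ζ̃ b)‖ ≤ ‖ζ̃ b‖³∕6` bondwise (px17 ✓`norm_sinc_smul_sub_self_le`, isometry of `coord`). [cite: Balaban1985UV3, p. 260 (bookkeeping)] -/
theorem norm_sinc_sub_one_smul_coord_le (x : EuclideanSpace ℝ (Fin 3)) :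
    ‖(Real.sinc ‖x‖ - 1) • (⟨su2Coord (rev x), su2Coord_rev_mem_lie x⟩ : (specialUnitaryLogChart (Fin 2)).lie)‖ ≤ ‖x‖ ^ 3 / 6 := by
  rw [norm_smul, norm_coord_eq, ← norm_smul, sub_smul, one_smul]
  exact norm_sinc_smul_sub_self_le x

/-- ★★★ **THE NORM FORM**: under Q1's guard at `(J,K)` and the window at `B`,
`‖Mq ζ̃ B − DMq (sinc∘ζ̃•ζ̃) B‖ ≤ ‖y − DΨ_{K−J}(0) X (σB)‖ + ‖y‖³∕6 + ‖DΨ_{K−J}(0) ((sinc∘ζ̃ − 1)•X) (σB)‖` — TAYLOR♭_q's summand (px17) ∕ each one-step bracket of Q7's telescope IS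
(β)'s `‖Ψ(X) − DΨ(0)X‖` at `σB` up to two third-order terms. [cite: Balaban1985Averaging, Prop. 3 (123) p.36, (148)-(149) p.40; Balaban1987RG1, (0.4), (0.11) p.253; Balaban1985UV3, p. 260] -/
theorem norm_qRead_sub_qfderiv_sinc_le {J K : ℕ} (hJK : J ≤ K) {θ : ℕ → ℝ} (hθ0 : ∀ i, 0 ≤ θ i) {α : ℝ}
    (hθα : ∀ i, J < i → i ≤ K → (((5 * F.L : ℕ) : ℝ) ^ 2 / 4) * θ i ≤ α)
    (hα24 : α ≤ 1 / 24) (hαδ : α < deltaSU (Fin 2)) (hαL : 157 * α < ((F.L : ℝ) ^ 2)⁻¹)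
    {U₀ : GaugeField (F.P K) 0 (SU 2)} (hUg : U₀ ∈ histGood F ℰp θ K J)
    (ζ : PBond (F.P K) 0 → EuclideanSpace ℝ (Fin 3)) (B : PBond (F.P J) 0)
    (hwin : ‖((descendTo F ℰp J K hJK (fun ℓ => expPoint (ζ ℓ) * U₀ ℓ) B * (descendTo F ℰp J K hJK U₀ B)⁻¹ : SU 2) : Matrix (Fin 2) (Fin 2) ℂ) - 1‖ <
      innerRadius (specialUnitaryLogChart (Fin 2))) :
    ‖imVec (su2Quat (descendTo F ℰp J K hJK (fun ℓ => expPoint (ζ ℓ) * U₀ ℓ) B * (descendTo F ℰp J K hJK U₀ B)⁻¹)) -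
        fderiv ℝ (fun (ζ : PBond (F.P K) 0 → EuclideanSpace ℝ (Fin 3)) (B : PBond (F.P J) 0) =>
          imVec (su2Quat (descendTo F ℰp J K hJK (fun ℓ => expPoint (ζ ℓ) * U₀ ℓ) B * (descendTo F ℰp J K hJK U₀ B)⁻¹))) 0
          (fun ℓ => Real.sinc ‖ζ ℓ‖ • ζ ℓ) B‖ ≤
      ‖(isChartRep_specialUnitaryGroup (n := Fin 2)).logChart
            (descendTo F ℰp J K hJK (fun ℓ => expPoint (ζ ℓ) * U₀ ℓ) B * (descendTo F ℰp J K hJK U₀ B)⁻¹) -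
          fderiv ℝ (fun (A : PBond (F.P K) 0 → (specialUnitaryLogChart (Fin 2)).lie) (c : PBond (F.P K) (K - J)) =>
              (isChartRep_specialUnitaryGroup (n := Fin 2)).logChart
                (Averaging.iter (fun i => blockAvg (P := F.P K) (j := i) (expMeanLogSU (n := Fin 2))) (K - J)
                    (fun b => (isChartRep_specialUnitaryGroup (n := Fin 2)).expChart (A b) * U₀ b) c *
                  (Averaging.iter (fun i => blockAvg (P := F.P K) (j := i) (expMeanLogSU (n := Fin 2))) (K - J) U₀ c)⁻¹)) 0
            (fun b => (⟨su2Coord (rev (ζ b)), su2Coord_rev_mem_lie (ζ b)⟩ : (specialUnitaryLogChart (Fin 2)).lie))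
            (bondShift (F.sitesPerDir_eq (m := F.m) (K := J) (j := 0) (m' := F.m) (K' := K) (j' := K - J) (by omega)) B)‖ +
      ‖(isChartRep_specialUnitaryGroup (n := Fin 2)).logChart
            (descendTo F ℰp J K hJK (fun ℓ => expPoint (ζ ℓ) * U₀ ℓ) B * (descendTo F ℰp J K hJK U₀ B)⁻¹)‖ ^ 3 / 6 +
      ‖fderiv ℝ (fun (A : PBond (F.P K) 0 → (specialUnitaryLogChart (Fin 2)).lie) (c : PBond (F.P K) (K - J)) =>
              (isChartRep_specialUnitaryGroup (n := Fin 2)).logChart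
                (Averaging.iter (fun i => blockAvg (P := F.P K) (j := i) (expMeanLogSU (n := Fin 2))) (K - J)
                    (fun b => (isChartRep_specialUnitaryGroup (n := Fin 2)).expChart (A b) * U₀ b) c *
                  (Averaging.iter (fun i => blockAvg (P := F.P K) (j := i) (expMeanLogSU (n := Fin 2))) (K - J) U₀ c)⁻¹)) 0
            (fun b => (Real.sinc ‖ζ b‖ - 1) • (⟨su2Coord (rev (ζ b)), su2Coord_rev_mem_lie (ζ b)⟩ : (specialUnitaryLogChart (Fin 2)).lie))
            (bondShift (F.sitesPerDir_eq (m := F.m) (K := J) (j := 0) (m' := F.m) (K' := K) (j' := K - J) (by omega)) B)‖ := by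
  have key := congrArg (fun z : (specialUnitaryLogChart (Fin 2)).lie => ‖z‖) (coord_qRead_sub_qfderiv_sinc_eq (F := F) hJK hθ0 hθα hα24 hαδ hαL hUg ζ B hwin)
  simp only [norm_coord_eq] at key
  rw [key]
  set y := (isChartRep_specialUnitaryGroup (n := Fin 2)).logChart
      (descendTo F ℰp J K hJK (fun ℓ => expPoint (ζ ℓ) * U₀ ℓ) B * (descendTo F ℰp J K hJK U₀ B)⁻¹) with hy
  have hb : ‖(Real.sinc ‖y‖ - 1) • y‖ ≤ ‖y‖ ^ 3 / 6 := by
    rw [sub_smul, one_smul]; exact norm_sinc_smul_sub_self_le y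
  exact (norm_add_le_of_le le_rfl (norm_sub_le_of_le hb le_rfl)).trans (le_of_eq (add_assoc _ _ _).symm)

end Remainder

/-! ## §4 The third-order derivative term priced by (D2) -/

section Priced

/-- ★★ **THE NORM FORM WITH THE DERIVATIVE TERM PRICED BY (D2)** (✓`…DerivKStepSupT3.norm_fderiv_chartRead_descendTo_expPoint_apply_le` through (E)
✓`fderiv_chartRead_descendTo_expPoint_apply`; Q1's guard at `(J,K)`, the window at `B`): with `X := coord∘ζ̃`, `y := Ψ_{K−J}(X)(σB)`,
`‖Mq ζ̃ B − DMq (sinc∘ζ̃•ζ̃) B‖ ≤ ‖y − DΨ_{K−J}(0) X (σB)‖ + ‖y‖³∕6 + (1 + 4(d+2))·exp(c₃·Σ_{i<K−J}(5L)²∕4·θ(K−i))·L^{K−J}·(‖ζ̃‖_∞³∕6)`, `c₃ = (d+2)(422 + 1616(d+2))` — so (β)'s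
`‖Ψ(X) − DΨ(0)X‖` at `σB` is ALL that is left of TAYLOR♭_q's summand ∕ a Q7 bracket, up to two explicit cubes. [cite: Balaban1985Averaging, Prop. 3 (123) p.36, (139)-(149) pp.39-40; Balaban1987RG1, (0.11) p.253; Balaban1985UV3, (7) p.257, p.260] -/
theorem norm_qRead_sub_qfderiv_sinc_le_priced {J K : ℕ} (hJK : J ≤ K) {θ : ℕ → ℝ} (hθ0 : ∀ i, 0 ≤ θ i) {α : ℝ}
    (hθα : ∀ i, J < i → i ≤ K → (((5 * F.L : ℕ) : ℝ) ^ 2 / 4) * θ i ≤ α)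
    (hα24 : α ≤ 1 / 24) (hαδ : α < deltaSU (Fin 2)) (hαL : 157 * α < ((F.L : ℝ) ^ 2)⁻¹)
    {U₀ : GaugeField (F.P K) 0 (SU 2)} (hUg : U₀ ∈ histGood F ℰp θ K J)
    (ζ : PBond (F.P K) 0 → EuclideanSpace ℝ (Fin 3)) (B : PBond (F.P J) 0)
    (hwin : ‖((descendTo F ℰp J K hJK (fun ℓ => expPoint (ζ ℓ) * U₀ ℓ) B * (descendTo F ℰp J K hJK U₀ B)⁻¹ : SU 2) : Matrix (Fin 2) (Fin 2) ℂ) - 1‖ <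
      innerRadius (specialUnitaryLogChart (Fin 2))) :
    ‖imVec (su2Quat (descendTo F ℰp J K hJK (fun ℓ => expPoint (ζ ℓ) * U₀ ℓ) B * (descendTo F ℰp J K hJK U₀ B)⁻¹)) -
        fderiv ℝ (fun (ζ : PBond (F.P K) 0 → EuclideanSpace ℝ (Fin 3)) (B : PBond (F.P J) 0) =>
          imVec (su2Quat (descendTo F ℰp J K hJK (fun ℓ => expPoint (ζ ℓ) * U₀ ℓ) B * (descendTo F ℰp J K hJK U₀ B)⁻¹))) 0
          (fun ℓ => Real.sinc ‖ζ ℓ‖ • ζ ℓ) B‖ ≤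
      ‖(isChartRep_specialUnitaryGroup (n := Fin 2)).logChart
            (descendTo F ℰp J K hJK (fun ℓ => expPoint (ζ ℓ) * U₀ ℓ) B * (descendTo F ℰp J K hJK U₀ B)⁻¹) -
          fderiv ℝ (fun (A : PBond (F.P K) 0 → (specialUnitaryLogChart (Fin 2)).lie) (c : PBond (F.P K) (K - J)) =>
              (isChartRep_specialUnitaryGroup (n := Fin 2)).logChart
                (Averaging.iter (fun i => blockAvg (P := F.P K) (j := i) (expMeanLogSU (n := Fin 2))) (K - J)
                    (fun b => (isChartRep_specialUnitaryGroup (n := Fin 2)).expChart (A b) * U₀ b) c *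
                  (Averaging.iter (fun i => blockAvg (P := F.P K) (j := i) (expMeanLogSU (n := Fin 2))) (K - J) U₀ c)⁻¹)) 0
            (fun b => (⟨su2Coord (rev (ζ b)), su2Coord_rev_mem_lie (ζ b)⟩ : (specialUnitaryLogChart (Fin 2)).lie))
            (bondShift (F.sitesPerDir_eq (m := F.m) (K := J) (j := 0) (m' := F.m) (K' := K) (j' := K - J) (by omega)) B)‖ +
      ‖(isChartRep_specialUnitaryGroup (n := Fin 2)).logChart
            (descendTo F ℰp J K hJK (fun ℓ => expPoint (ζ ℓ) * U₀ ℓ) B * (descendTo F ℰp J K hJK U₀ B)⁻¹)‖ ^ 3 / 6 +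
      (1 + 4 * (((F.P K).d + 2 : ℕ) : ℝ)) *
          Real.exp ((((F.P K).d + 2 : ℕ) : ℝ) * (422 + 1616 * (((F.P K).d + 2 : ℕ) : ℝ)) *
            ∑ i ∈ Finset.range (K - J), (((5 * F.L : ℕ) : ℝ) ^ 2 / 4) * θ (K - i)) *
        ((F.P K).L : ℝ) ^ (K - J) * (‖ζ‖ ^ 3 / 6) := by
  have hθδ : ∀ i, J < i → i ≤ K → (((5 * F.L : ℕ) : ℝ) ^ 2 / 4) * θ i < deltaSU (Fin 2) := fun i hi hiK => (hθα i hi hiK).trans_lt hαδ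
  have hθ24 : ∀ i, J < i → i ≤ K → (((5 * F.L : ℕ) : ℝ) ^ 2 / 4) * θ i ≤ 1 / 24 := fun i hi hiK => (hθα i hi hiK).trans hα24
  refine (norm_qRead_sub_qfderiv_sinc_le (F := F) hJK hθ0 hθα hα24 hαδ hαL hUg ζ B hwin).trans (add_le_add le_rfl ?_)
  -- the third-order input field `w b := (sinc‖ζ b‖ − 1) • ζ b` and its coordinates
  set w : PBond (F.P K) 0 → EuclideanSpace ℝ (Fin 3) := fun b => (Real.sinc ‖ζ b‖ - 1) • ζ b with hw
  have hcw : (fun b : PBond (F.P K) 0 => (Real.sinc ‖ζ b‖ - 1) • (⟨su2Coord (rev (ζ b)), su2Coord_rev_mem_lie (ζ b)⟩ : (specialUnitaryLogChart (Fin 2)).lie)) =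
      fun b => (⟨su2Coord (rev (w b)), su2Coord_rev_mem_lie (w b)⟩ : (specialUnitaryLogChart (Fin 2)).lie) := by
    funext b; rw [hw]; exact (coord_smul _ _).symm
  have hE := fderiv_chartRead_descendTo_expPoint_apply (F := F) hJK hθ0 hθδ hUg w B
  rw [hcw, ← hE, Submodule.coe_norm]
  refine (norm_fderiv_chartRead_descendTo_expPoint_apply_le (F := F) hJK hθ0 hθ24 hθδ hUg w B).trans ?_
  have hC : 0 ≤ (1 + 4 * (((F.P K).d + 2 : ℕ) : ℝ)) *
      Real.exp ((((F.P K).d + 2 : ℕ) : ℝ) * (422 + 1616 * (((F.P K).d + 2 : ℕ) : ℝ)) *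
        ∑ i ∈ Finset.range (K - J), (((5 * F.L : ℕ) : ℝ) ^ 2 / 4) * θ (K - i)) * ((F.P K).L : ℝ) ^ (K - J) := by positivity
  refine mul_le_mul_of_nonneg_left ?_ hC
  -- `‖w‖_∞ ≤ ‖ζ‖_∞³ / 6`
  refine (pi_norm_le_iff_of_nonneg (by positivity)).2 fun b => ?_
  have hb : ‖w b‖ ≤ ‖ζ b‖ ^ 3 / 6 := by
    rw [hw]; dsimp only; rw [sub_smul, one_smul]; exact norm_sinc_smul_sub_self_le (ζ b)
  have hζb : ‖ζ b‖ ≤ ‖ζ‖ := norm_le_pi_norm ζ b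
  exact hb.trans (div_le_div_of_nonneg_right (pow_le_pow_left₀ (norm_nonneg _) hζb 3) (by norm_num))

end Priced

end Summit.QuantumFields.YangMills.Theorems.FluctuationComparisonRegPrIntLS2BetaQuaternionReadRemainderDictionary

end
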